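import Literature.AlgebraicGeometry.Motives.HodgeLieWeilClassesProduct
import Summits.HodgeConjecture.CorCM.MumfordTateRankQuadraticFieldAction
import HarnessLib

/-!
# CM elliptic curve × simple type-IV(2,1) threefold with the SAME imaginary quadratic field: `dim MT(H¹(E × T)) = 10`
# (Moonen–Zarhin 1999 Thm. 0.1 (4)(a): `Hg(E × T) ≠ Hg(E) × Hg(T)`, the Weil classes of the diagonal `k`-action on `E × T`)

COR-CM (cell `pub-hodgecm2`, seat `b27` gen 48, count-neutral Mumford–Tate-rank ladder; theorems only, no definition, no named fact;
UNCONDITIONAL — nothing here uses or asserts HC_CM).  The last fourfold cell `E × T`: `E` an elliptic curve with complex multiplication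
`χ ∘ χ = −D`, `T` a simple abelian threefold with `dim_ℚ End⁰T = 2` and `φ ∘ φ = −D` (the SAME `D`: `End⁰E ≅ ℚ(√−D) ≅ End⁰T`), the two
square roots matched so that the multiplicities of `i√D` on `H^{1,0}(E)` and on `H^{1,0}(T)` add up to `2` (replace `χ` by `−χ` otherwise).
Then the diagonal action of `k = End⁰E` on `H¹(T × E)` (through `k → End⁰T`, `χ ↦ φ`) is OF WEIL TYPE (`2·(n_σ(T) + n_σ(E)) = 4`), its Weil
classes `⋀⁴_k H¹(T × E) ⊂ H⁴` are Hodge classes moved by `0 ⊕ χ^*` (`Motives/HodgeLieWeilClassesProduct`), so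
`dim Lie Hg(H¹(T × E)) < dim Lie Hg(H¹T) + dim Lie Hg(H¹E) = 9 + 1`; with the monotonicity `dim Lie Hg(H¹(T × E)) ≥ dim Lie Hg(H¹T) = 9`
(`T` is `Θ`-rigid, `CorCM/MumfordTateRankRigidMonotone`): **`dim Lie Hg = 9`, `t(E × T) = 10`** — versus `11` when the fields differ
(`CorCM/MumfordTateRankTimesCMCurve`).  With this file the curve × simple-threefold table of Mumford–Tate ranks is complete:
`{4, 5, 7, 10, 11, 13, 23, 25}`.

* §1 (moved to `CorCM/MumfordTateRankQuadraticFieldAction`): `exists_ringHom_apply_eq_of_sq_eq_neg` (`K ∋ c`, `c² = −D` maps to any `R ∋ b`, `b² = −D`,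
  `c ↦ b`), `multiplicity_hOneEndAction_eq_eigenMultiplicity` (`n_σ = eigenMultiplicity A ψ (σ c)`), `apply_eq_or_eq_neg_of_sq_eq_neg` (`σ(c) = ± i√D`).
* §2 **`finrank_hodgeLie_hodge_one_threefold_prod_cmCurve_sameField`** (`dim Lie Hg(H¹(T × E)) = 9`) and
  **`mtRank_hodge_one_eq_ten_of_isIsogenous_cmCurve_prod_isSimple_threefold_sameField`** (`t(X) = 10` for `X ∼ E × T`).
* §3 FIELD FORM — `exists_matched_cm_data_of_ringHom` (a ring hom `End⁰E → End⁰T` yields matched data `χ, φ, D` as above: `f(χ₀) = M⁻¹ ⊗ F`,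
  Mumford §19 Thm. 3; sign of `χ` fixed by the multiplicities), **`mtRank_hodge_one_eq_ten_of_isIsogenous_cmCurve_prod_isSimple_threefold_of_nonempty_ringHom`**
  and the whole column as iffs: **`t(E × T) = 10 ↔ Nonempty (End⁰E →+* End⁰T)`**, **`t(E × T) = 11 ↔ IsEmpty (End⁰E →+* End⁰T)`**
  (`mtRank_hodge_one_eq_ten_iff_nonempty_ringHom_…`, `mtRank_hodge_one_eq_eleven_iff_isEmpty_ringHom_…`; the `11` from `CorCM/MumfordTateRankTimesCMCurve`).

## References
* [MoonenZarhin1999LowDim] B. Moonen, Yu. G. Zarhin, Math. Ann. 315 (1999), Thm. 0.1 (4)(a), Thm. (0.2) (1), §2 (2.3), §3 (3.1), Prop. (3.8)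
  [corpus: paper:arxiv-math_9901113 pp. 1–2, 5–7]. [cite: MoonenZarhin1999LowDim, Thm. 0.1 (4) and §3 (3.1)]
* [Deligne1982HodgeCycles] P. Deligne, LNM 900 (1982), §4 Prop. 4.4 (Weil classes). [cite: Deligne1982HodgeCycles, §4 Prop. 4.4]
* [Shimura1998] G. Shimura, *Abelian Varieties with Complex Multiplication and Modular Functions*, §5.1 Prop. 5 and Prop. 14. [cite: Shimura1998, §5.1 Proposition 5 (p. 36)]
* [MumfordAV1970] D. Mumford, *Abelian Varieties* (1970), §19 Thm. 3 and Cor. 2 (`End⁰ = End ⊗ ℚ`). [cite: MumfordAV1970, §19 Thm. 3 and Cor. 2]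
* [LangeBirkenhake1992] H. Lange, Ch. Birkenhake, *Complex Abelian Varieties* (1992), §1.1 (the analytic representation). [cite: LangeBirkenhake1992, §1.1 (p. 19)]
-/

noncomputable section

open scoped TensorProduct
open CategoryTheory CategoryTheory.Limits Module

namespace Summit.HodgeConjecture.CorCM

open Literature.AlgebraicGeometry.Motives
open Literature.AlgebraicGeometry.Motives.AbelianVariety
open Literature.AlgebraicGeometry.Motives.HodgeStructure
open Literature.AlgebraicGeometry.HodgeTheory
open Literature.AlgebraicGeometry.ComplexMultiplication
open Literature.AlgebraicGeometry.Milne1999 (IsOfCMType)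

/-! ## §2 The same-field cell: `dim Lie Hg(H¹(T × E)) = 9`, `t(E × T) = 10` -/

variable [HodgeTensorFacts.{0, 0}] {X : AbelianVariety ℂ} {n : ℕ}

/-- **`dim Lie Hg(H¹(T × E)) = 9` for a simple type-IV(2,1) threefold `T` and a CM elliptic curve `E` with the SAME field, matched roots.**
`χ ∘ χ = −D` on `E`, `φ ∘ φ = −D` on `T` (`dim_ℚ End⁰T = 2`, `T` simple of dimension `3`), and the multiplicities of `i√D` on `H^{1,0}(E)` and on
`H^{1,0}(T)` add up to `2`.  The diagonal action of `k = End⁰E` on `H¹(T × E)` (`χ ↦ φ` on the first factor) is of Weil type, so the corner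
`0 ⊕ χ^*` is not in `Lie Hg(H¹(T × E))` (`finrank_hodgeLie_lt_add_of_weilType`: `< 9 + 1`), while `Lie Hg(H¹(T × E)) ↠ Lie Hg(H¹T)` (`T` rigid:
`≥ 9`). [cite: MoonenZarhin1999LowDim, Thm. 0.1 (4) and §3 (3.1)] [cite: Deligne1982HodgeCycles, §4 Prop. 4.4] -/
theorem finrank_hodgeLie_hodge_one_threefold_prod_cmCurve_sameField {E T : AbelianVariety ℂ} {m : ℕ} (hP : IsSmoothProjective m (T.prod E).X)
    (hE1 : E.dim = 1) (hTs : T.IsSimple) (hT3 : T.dim = 3) (hTE : Module.finrank ℚ T.endAlgebra = 2) (χ : E ⟶ E) (φ : T ⟶ T) {D : ℕ}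
    (hD : 0 < D) (hχ : χ ≫ χ = -(D • 𝟙 E)) (hφ : φ ≫ φ = -(D • 𝟙 T))
    (hmult : eigenMultiplicity E χ (Complex.I * (Real.sqrt D : ℂ)) + eigenMultiplicity T φ (Complex.I * (Real.sqrt D : ℂ)) = 2) :
    haveI := BettiUniverse.finite hP 1
    Module.finrank ℚ (BettiUniverse.hodge exists_isReal_hodgeModel_holds hP 1).hodgeLie = 9 := by
  classical
  have hnP : (T.prod E).dim = m := schemeDim_eq_holds hP
  subst hnP
  have hT : IsSmoothProjective T.dim T.X := AbelianVariety.isSmoothProjective_holds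
  have hE : IsSmoothProjective E.dim E.X := AbelianVariety.isSmoothProjective_holds
  haveI := BettiUniverse.finite hP 1
  haveI := BettiUniverse.finite hT 1
  haveI := BettiUniverse.finite hE 1
  -- `≥ 9`: `T` is rigid with `dim Lie Hg(H¹T) = 9`
  have h9 : Module.finrank ℚ (BettiUniverse.hodge exists_isReal_hodgeModel_holds hT 1).hodgeLie = 9 :=
    (mtRank_hodge_one_of_isSimple_threefold_of_finrank_endAlgebra_eq_two hT hTs hT3 hTE).2
  have hge := finrank_hodgeLie_hodge_one_le_prod_of_rigid (X₂ := E) hT hP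
    (hodgeLie_rigid_of_isSimple_threefold_of_finrank_endAlgebra_eq_two hT hTs hT3 hTE)
  -- `E` is a CM curve: `End⁰E` a quadratic field `K`, `dim Lie Hg(H¹E) = 1 ∋ χ^*`
  obtain ⟨hEcm, h2E⟩ := isOfCMType_and_mtRank_eq_two_of_curve_of_comp_self_eq_neg hE hE1 χ hD hχ
  have hE2 : Module.finrank ℚ E.endAlgebra = 2 := finrank_endAlgebra_eq_two_of_cmCurve hE1 hEcm
  have hFE : IsField E.endAlgebra := AbelianVariety.isField_endAlgebra_of_isSimple_of_finrank_eq_two (isSimple_of_dim_le_one hE1.le)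
    (by omega) hE2
  haveI : Module.Finite ℚ (EndField E hFE) := NumberField.to_finiteDimensional
  have hK2 : Module.finrank ℚ (EndField E hFE) = 2 := by rw [EndField.finrank_eq, hE2]
  let ρE : EndField E hFE →+* E.endAlgebra := (EndField.toEndAlgebra hFE).toRingHom
  let c : EndField E hFE := (EndField.toEndAlgebra hFE).symm (AbelianVariety.endAlgebra.of E χ)
  have hρEc : ρE c = AbelianVariety.endAlgebra.of E χ := (EndField.toEndAlgebra hFE).apply_symm_apply _
  have hcK : c * c = -((D : ℚ) • (1 : EndField E hFE)) := by
    apply (EndField.toEndAlgebra hFE).injective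
    rw [map_mul, (EndField.toEndAlgebra hFE).apply_symm_apply, endAlgebra_of_mul_self_eq_neg hχ, map_neg, Nat.cast_smul_eq_nsmul,
      Nat.cast_smul_eq_nsmul, map_nsmul, map_one]
  have hc0 : c ≠ 0 := by
    intro h
    rw [h, mul_zero, eq_comm, neg_eq_zero, smul_eq_zero] at hcK
    rcases hcK with h' | h'
    · exact hD.ne' (by exact_mod_cast h')
    · exact one_ne_zero h'
  -- `k → End⁰T`, `c ↦ φ`
  obtain ⟨ρT, hρTc⟩ := exists_ringHom_apply_eq_of_sq_eq_neg hK2 (Nat.cast_pos.2 hD) hcK (R := T.endAlgebra)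
    (b := AbelianVariety.endAlgebra.of T φ) (endAlgebra_of_mul_self_eq_neg hφ)
  -- the actions on the factors
  let A₁ : EndAction (BettiUniverse.hodge exists_isReal_hodgeModel_holds hT 1) (EndField E hFE) :=
    hOneEndAction ρT exists_isReal_hodgeModel_holds hodgePQ_independent_of_hodgeModel_holds
  let A₂ : EndAction (BettiUniverse.hodge exists_isReal_hodgeModel_holds hE 1) (EndField E hFE) :=
    hOneEndAction ρE exists_isReal_hodgeModel_holds hodgePQ_independent_of_hodgeModel_holds
  -- the bicone of `H¹(T × E)`
  let ι₁ := BettiUniverse.pullHodgeHom exists_isReal_hodgeModel_holds hodgePQ_independent_of_hodgeModel_holds hP hT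
    (fst T E).hom.hom.hom 1
  let π₁ := BettiUniverse.pullHodgeHom exists_isReal_hodgeModel_holds hodgePQ_independent_of_hodgeModel_holds hT hP
    (prodLift (𝟙 T) (0 : T ⟶ E)).hom.hom.hom 1
  let ι₂ := BettiUniverse.pullHodgeHom exists_isReal_hodgeModel_holds hodgePQ_independent_of_hodgeModel_holds hP hE
    (snd T E).hom.hom.hom 1
  let π₂ := BettiUniverse.pullHodgeHom exists_isReal_hodgeModel_holds hodgePQ_independent_of_hodgeModel_holds hE hP
    (prodLift (0 : E ⟶ T) (𝟙 E)).hom.hom.hom 1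
  have hsumP : fst T E ≫ prodLift (𝟙 T) (0 : T ⟶ E) + snd T E ≫ prodLift (0 : E ⟶ T) (𝟙 E) = 𝟙 _ := by
    refine prod_hom_ext ?_ ?_
    · rw [Preadditive.add_comp, Category.assoc, Category.assoc, prodLift_fst, prodLift_fst, Category.comp_id,
        comp_zero, add_zero, Category.id_comp]
    · rw [Preadditive.add_comp, Category.assoc, Category.assoc, prodLift_snd, prodLift_snd, Category.comp_id,
        comp_zero, zero_add, Category.id_comp]
  have hπι₁ : ∀ v, π₁.toLinearMap (ι₁.toLinearMap v) = v := fun v => pull_pull_eq_self_of_comp_eq_id (prodLift_fst _ _) v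
  have hπι₂ : ∀ v, π₂.toLinearMap (ι₂.toLinearMap v) = v := fun v => pull_pull_eq_self_of_comp_eq_id (prodLift_snd _ _) v
  have hsum : ∀ v, ι₁.toLinearMap (π₁.toLinearMap v) + ι₂.toLinearMap (π₂.toLinearMap v) = v := fun v =>
    pull_pull_add_pull_pull_eq_self _ _ _ _ hsumP v
  have h12 : ∀ v, π₁.toLinearMap (ι₂.toLinearMap v) = 0 := fun v => by
    have h := congrArg π₁.toLinearMap (hsum (ι₂.toLinearMap v))
    rw [map_add, hπι₂ v, hπι₁] at h
    exact add_eq_left.1 h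
  have h21 : ∀ v, π₂.toLinearMap (ι₁.toLinearMap v) = 0 := fun v => by
    have h := congrArg π₂.toLinearMap (hsum (ι₁.toLinearMap v))
    rw [map_add, hπι₁ v, hπι₂] at h
    exact add_eq_left.1 h
  -- the diagonal action on `H¹(T × E)`
  let L : EndField E hFE →ₗ[ℚ] Module.End ℚ (bettiCohomology (T.prod E).X 1) :=
    { toFun := fun a => ι₁.toLinearMap ∘ₗ A₁.ι a ∘ₗ π₁.toLinearMap + ι₂.toLinearMap ∘ₗ A₂.ι a ∘ₗ π₂.toLinearMap
      map_add' := fun a b => by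
        rw [map_add, map_add, LinearMap.add_comp, LinearMap.comp_add, LinearMap.add_comp, LinearMap.comp_add]; abel
      map_smul' := fun q a => by
        rw [map_smul, map_smul, LinearMap.smul_comp, LinearMap.comp_smul, LinearMap.smul_comp, LinearMap.comp_smul, RingHom.id_apply,
          smul_add] }
  have hL : ∀ a, L a = ι₁.toLinearMap ∘ₗ A₁.ι a ∘ₗ π₁.toLinearMap + ι₂.toLinearMap ∘ₗ A₂.ι a ∘ₗ π₂.toLinearMap := fun a => rfl
  have hL1 : L 1 = 1 := by
    rw [hL, map_one, map_one]
    refine LinearMap.ext fun v => ?_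
    rw [LinearMap.add_apply, LinearMap.comp_apply, LinearMap.comp_apply, LinearMap.comp_apply, LinearMap.comp_apply,
      Module.End.one_apply, Module.End.one_apply, Module.End.one_apply, hsum]
  have hLmul : ∀ a b, L (a * b) = L a * L b := by
    intro a b
    rw [hL, hL, hL, map_mul, map_mul]
    refine LinearMap.ext fun v => ?_
    simp only [LinearMap.add_apply, LinearMap.comp_apply, Module.End.mul_apply, map_add, hπι₁, hπι₂, h12, h21, map_zero,
      add_zero, zero_add]
  have hLmem : ∀ a, L a ∈ (BettiUniverse.hodge exists_isReal_hodgeModel_holds hP 1).endAlg := fun a =>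
    Subalgebra.add_mem _ (((ι₁.comp (endAlg.toHom ⟨A₁.ι a, fun p => A₁.map_F_le a p⟩)).comp π₁).toLinearMap_mem_endAlg)
      (((ι₂.comp (endAlg.toHom ⟨A₂.ι a, fun p => A₂.map_F_le a p⟩)).comp π₂).toLinearMap_mem_endAlg)
  let A : EndAction (BettiUniverse.hodge exists_isReal_hodgeModel_holds hP 1) (EndField E hFE) := { ι := AlgHom.ofLinearMap L hL1 hLmul, map_F_le := fun a p => hLmem a p }
  have hAι : ∀ a, A.ι a = L a := fun a => rfl
  have hA₁ : ∀ a, A.ι a ∘ₗ ι₁.toLinearMap = ι₁.toLinearMap ∘ₗ A₁.ι a := fun a => by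
    rw [hAι, hL]
    refine LinearMap.ext fun v => ?_
    simp only [LinearMap.add_apply, LinearMap.comp_apply, hπι₁, h21, map_zero, add_zero]
  have hA₂ : ∀ a, A.ι a ∘ₗ ι₂.toLinearMap = ι₂.toLinearMap ∘ₗ A₂.ι a := fun a => by
    rw [hAι, hL]
    refine LinearMap.ext fun v => ?_
    simp only [LinearMap.add_apply, LinearMap.comp_apply, hπι₂, h12, map_zero, zero_add]
  -- Weil type of the total action: `2 (n_σ(T) + n_σ(E)) = 4`
  have hsumE := eigenMultiplicity_add_eigenMultiplicity_neg_eq_dim E χ hD hχ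
  have hsumT := eigenMultiplicity_add_eigenMultiplicity_neg_eq_dim T φ hD hφ
  rw [hE1] at hsumE
  rw [hT3] at hsumT
  have hV : Module.finrank ℚ (bettiCohomology (T.prod E).X 1) = 8 := by rw [finrank_bettiCohomology_one, dim_prod, hT3, hE1]
  have hW : ∀ σ : EndField E hFE →+* ℂ, 2 * (A₁.multiplicity σ + A₂.multiplicity σ) =
      Module.finrank ℚ (bettiCohomology (T.prod E).X 1) / 2 := by
    intro σ
    rw [hV, multiplicity_hOneEndAction_eq_eigenMultiplicity ρT hK2 hD hcK φ hρTc σ,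
      multiplicity_hOneEndAction_eq_eigenMultiplicity ρE hK2 hD hcK χ hρEc σ]
    rcases apply_eq_or_eq_neg_of_sq_eq_neg hcK σ with h | h <;> rw [h] <;> omega
  have hV₂ : Module.finrank ℚ (bettiCohomology E.X 1) = 2 := by rw [finrank_bettiCohomology_one, hE1]
  have heff := BettiUniverse.hodge_isEffective exists_isReal_hodgeModel_holds hP 1
  -- `χ^* ∈ Lie Hg(H¹E)` (a line containing only rational multiples of `χ^*`)
  have hχmem : A₂.ι c ∈ (BettiUniverse.hodge exists_isReal_hodgeModel_holds hE 1).hodgeLie := by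
    have hA₂c : A₂.ι c = (bettiCohomology.map χ.hom.hom.hom 1).hom := by
      change hOneAlgHom ρE c = _
      rw [hOneAlgHom_apply, hρEc, bettiRep_of, MulOpposite.unop_op]
    rw [hA₂c]
    have h1 : Module.finrank ℚ (BettiUniverse.hodge exists_isReal_hodgeModel_holds hE 1).hodgeLie = 1 := by
      have h := mtRank_hodge_one_eq_finrank_hodgeLie_add_one hE (by omega)
      omega
    obtain ⟨Y, hY, hY0⟩ : ∃ Y ∈ (BettiUniverse.hodge exists_isReal_hodgeModel_holds hE 1).hodgeLie, Y ≠ 0 := by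
      by_contra h
      push Not at h
      have hbot : (BettiUniverse.hodge exists_isReal_hodgeModel_holds hE 1).hodgeLie = ⊥ := (Submodule.eq_bot_iff _).2 h
      rw [hbot, finrank_bot] at h1
      exact absurd h1 (by norm_num)
    obtain ⟨ψE⟩ := BettiUniverse.hodge_isPolarizable exists_isReal_hodgeModel_holds hE 1
    obtain ⟨hχE, hχ2, -⟩ := quadraticEnd_skewCentre_data exists_isReal_hodgeModel_holds hodgePQ_independent_of_hodgeModel_holds
      (by omega) hE2 hD hχ ψE
    obtain ⟨q, hq⟩ := RankTwoCM.exists_eq_ratCast_smul_of_commute_of_skew _ Nat.cast_one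
      (BettiUniverse.hodge_isEffective exists_isReal_hodgeModel_holds hE 1) hV₂ ψE hχE (Nat.cast_pos.2 hD) hχ2
      (commute_of_mem_hodgeLie _ hY ⟨_, hχE⟩) (form_apply_add_eq_zero_of_mem_hodgeLie ψE hY)
    have hq0 : q ≠ 0 := by rintro rfl; rw [zero_smul] at hq; exact hY0 hq
    have hmem : q⁻¹ • Y ∈ (BettiUniverse.hodge exists_isReal_hodgeModel_holds hE 1).hodgeLie := Submodule.smul_mem _ _ hY
    rwa [hq, smul_smul, inv_mul_cancel₀ hq0, one_smul] at hmem
  -- the Weil-class obstruction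
  have hlt := finrank_hodgeLie_lt_add_of_weilType ι₁ π₁ ι₂ π₂ hπι₁ hπι₂ hsum A₁ A₂ A hA₁ hA₂ heff hK2 hV₂ hW hc0 hχmem
  have h1E : Module.finrank ℚ (BettiUniverse.hodge exists_isReal_hodgeModel_holds hE 1).hodgeLie = 1 := by
    have h := mtRank_hodge_one_eq_finrank_hodgeLie_add_one hE (by omega)
    omega
  rw [h9, h1E] at hlt
  rw [h9] at hge
  omega

/-- **SAME-FIELD CELL: `dim MT(H¹(E × T)) = 10` for a CM elliptic curve `E` and a simple abelian threefold `T` with `dim_ℚ End⁰T = 2` whose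
imaginary quadratic fields coincide** — data: `χ ∘ χ = −D` on `E`, `φ ∘ φ = −D` on `T` with the roots matched
(`n_{i√D}(E) + n_{i√D}(T) = 2`; replace `χ` by `−χ` if the sum is `1` or `3`).  Moonen–Zarhin Thm. 0.1 (4)(a): the exceptional (Weil) classes of
`E × T` force `Hg(E × T) ⊊ Hg(E) × Hg(T)`; compare `11` for different fields (`CorCM/MumfordTateRankTimesCMCurve`).
[cite: MoonenZarhin1999LowDim, Thm. 0.1 (4) and §3 (3.1)] [cite: Deligne1982HodgeCycles, §4 Prop. 4.4] -/
theorem mtRank_hodge_one_eq_ten_of_isIsogenous_cmCurve_prod_isSimple_threefold_sameField (hX : IsSmoothProjective n X.X)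
    {E T : AbelianVariety ℂ} (hE1 : E.dim = 1) (hTs : T.IsSimple) (hT3 : T.dim = 3) (hTE : Module.finrank ℚ T.endAlgebra = 2) (χ : E ⟶ E)
    (φ : T ⟶ T) {D : ℕ} (hD : 0 < D) (hχ : χ ≫ χ = -(D • 𝟙 E)) (hφ : φ ≫ φ = -(D • 𝟙 T))
    (hmult : eigenMultiplicity E χ (Complex.I * (Real.sqrt D : ℂ)) + eigenMultiplicity T φ (Complex.I * (Real.sqrt D : ℂ)) = 2)
    (hXP : IsIsogenous X (E.prod T)) :
    haveI := BettiUniverse.finite hX 1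
    (BettiUniverse.hodge exists_isReal_hodgeModel_holds hX 1).mtRank = 10 := by
  haveI := BettiUniverse.finite hX 1
  have hP : IsSmoothProjective (T.prod E).dim (T.prod E).X := AbelianVariety.isSmoothProjective_holds
  haveI := BettiUniverse.finite hP 1
  have h0 : 0 < X.dim := by
    obtain ⟨f, hf⟩ := hXP
    rw [dim_eq_of_isIsogeny hf, dim_prod]; omega
  have h9 := finrank_hodgeLie_hodge_one_threefold_prod_cmCurve_sameField hP hE1 hTs hT3 hTE χ φ hD hχ hφ hmult
  have hiso := finrank_hodgeLie_hodge_one_eq_of_isIsogenous hX hP (hXP.trans (isIsogenous_prod_comm E T))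
  rw [mtRank_hodge_one_eq_finrank_hodgeLie_add_one hX h0, hiso, h9]

/-! ## §3 Field form: `t(E × T) = 10 ↔ End⁰E ↪ End⁰T`, `= 11 ↔ End⁰E ↛ End⁰T` -/

section FieldForm

omit [HodgeTensorFacts.{0, 0}] in
/-- The multiplicity flips under `χ ↦ −χ`: `(−χ)^* = −χ^*` on `H¹`, so the `μ`-eigenspace of `−χ` is the `(−μ)`-eigenspace of `χ` (the tree's
`complexBetti_map_neg_one`; cf. ring2's `Ring2.Atlas.eigenMultiplicity_neg`). [cite: LangeBirkenhake1992, §1.1 (p. 19)] -/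
private theorem eigenMultiplicity_neg' {A : AbelianVariety ℂ} (χ : A ⟶ A) (μ : ℂ) :
    eigenMultiplicity A (-χ) μ = eigenMultiplicity A χ (-μ) := by
  have hE : Module.End.eigenspace (complexBetti.map (-χ).hom.hom.hom 1).hom μ =
      Module.End.eigenspace (complexBetti.map χ.hom.hom.hom 1).hom (-μ) := by
    rw [complexBetti_map_neg_one]
    ext x
    rw [Module.End.mem_eigenspace_iff, Module.End.mem_eigenspace_iff, ModuleCat.hom_neg, LinearMap.neg_apply, neg_smul]
    exact neg_eq_iff_eq_neg
  unfold eigenMultiplicity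
  rw [hE]

omit [HodgeTensorFacts.{0, 0}] in
/-- **MATCHED CM DATA FROM A RING HOM `End⁰E → End⁰T`**: for a CM elliptic curve `E`, a simple abelian threefold `T` and `f : End⁰E →+* End⁰T`
there are `χ : E ⟶ E`, `φ : T ⟶ T`, `D > 0` with `χ ∘ χ = −D`, `φ ∘ φ = −D` and `n_{i√D}(E) + n_{i√D}(T) = 2`.  Construction: `χ₀ ∘ χ₀ = −d'`
(Silverman III.9.4); `f(χ₀) = M⁻¹ ⊗ F` in `End⁰T = End T ⊗ ℚ` (Mumford §19 Thm. 3), so `φ := F`, `χ := M χ₀`, `D := M² d'`; the multiplicities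
of `φ` are `(2,1)` or `(1,2)` (`T` simple: both positive, sum `3`) and those of `χ` are `(1,0)` or `(0,1)` — replace `χ` by `−χ` if the sum is not `2`.
[cite: MumfordAV1970, §19 Thm. 3 and Cor. 2] [cite: Shimura1998, §5.1 Prop. 14 (p. 44)] -/
theorem exists_matched_cm_data_of_ringHom {E T : AbelianVariety ℂ} (hE1 : E.dim = 1) (hEcm : IsOfCMType E) (hTs : T.IsSimple) (hT3 : T.dim = 3)
    (f : E.endAlgebra →+* T.endAlgebra) :
    ∃ (χ : E ⟶ E) (φ : T ⟶ T) (D : ℕ), 0 < D ∧ χ ≫ χ = -(D • 𝟙 E) ∧ φ ≫ φ = -(D • 𝟙 T) ∧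
      eigenMultiplicity E χ (Complex.I * (Real.sqrt D : ℂ)) + eigenMultiplicity T φ (Complex.I * (Real.sqrt D : ℂ)) = 2 := by
  obtain ⟨χ₀, d', hd', hχ₀⟩ := exists_hom_comp_self_eq_neg_of_cmCurve hE1 hEcm
  -- `a := f(χ₀) ∈ End⁰T`, `a² = −d'`
  have ha : f (AbelianVariety.endAlgebra.of E χ₀) * f (AbelianVariety.endAlgebra.of E χ₀) = -((d' : ℚ) • 1) := by
    rw [← map_mul, endAlgebra_of_mul_self_eq_neg hχ₀, map_neg, Nat.cast_smul_eq_nsmul, Nat.cast_smul_eq_nsmul, map_nsmul, map_one]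
  -- `a = M⁻¹ ⊗ F`
  obtain ⟨M, F, hM, hMF⟩ := AbelianVariety.endAlgebra.exists_eq_algebraMap_mul_of (f (AbelianVariety.endAlgebra.of E χ₀))
  have hMQ : (M : ℚ) ≠ 0 := Nat.cast_ne_zero.2 hM
  have hF : AbelianVariety.endAlgebra.of T F = (M : ℚ) • f (AbelianVariety.endAlgebra.of E χ₀) := by
    rw [hMF, Algebra.algebraMap_eq_smul_one, smul_mul_assoc, one_mul, smul_smul, mul_inv_cancel₀ hMQ, one_smul]
  have hFF : F * F = -((M * M * d') • 1) := by
    apply AbelianVariety.endAlgebra.of_injective_of_charZero (A := T)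
    rw [map_mul, hF, smul_mul_smul_comm, ha, smul_neg, smul_smul, map_neg, map_nsmul, map_one,
      ← Nat.cast_smul_eq_nsmul ℚ (M * M * d') (1 : T.endAlgebra), Nat.cast_mul, Nat.cast_mul]
  have hφ : (F : T ⟶ T) ≫ F = -((M * M * d') • 𝟙 T) := hFF
  have hχ : (M • χ₀) ≫ (M • χ₀) = -((M * M * d') • 𝟙 E) := by
    rw [Preadditive.nsmul_comp, Preadditive.comp_nsmul, hχ₀, smul_neg, smul_neg, smul_smul, smul_smul]
  have hD : 0 < M * M * d' := Nat.mul_pos (Nat.mul_pos (Nat.pos_of_ne_zero hM) (Nat.pos_of_ne_zero hM)) hd'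
  have hsumE := eigenMultiplicity_add_eigenMultiplicity_neg_eq_dim E (M • χ₀) hD hχ
  have hsumT := eigenMultiplicity_add_eigenMultiplicity_neg_eq_dim T F hD hφ
  have hpos := AbelianVariety.eigenMultiplicity_pos_of_isSimple T hTs F hD hφ (by omega)
  rw [hE1] at hsumE
  rw [hT3] at hsumT
  by_cases h2 : eigenMultiplicity E (M • χ₀) (Complex.I * (Real.sqrt (M * M * d' : ℕ) : ℂ)) +
      eigenMultiplicity T F (Complex.I * (Real.sqrt (M * M * d' : ℕ) : ℂ)) = 2
  · exact ⟨M • χ₀, F, M * M * d', hD, hχ, hφ, h2⟩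
  · refine ⟨-(M • χ₀), F, M * M * d', hD, ?_, hφ, ?_⟩
    · rw [Preadditive.neg_comp, Preadditive.comp_neg, neg_neg, hχ]
    · rw [eigenMultiplicity_neg']
      omega

/-- **FIELD FORM OF THE SAME-FIELD CELL: `t(E × T) = 10` whenever `End⁰E` maps to `End⁰T`** (`E` a CM elliptic curve, `T` a simple abelian threefold with
`dim_ℚ End⁰T = 2`; a ring hom between the two imaginary quadratic fields is an isomorphism).  Compare `= 11` when there is NO ring hom
(`mtRank_hodge_one_eq_eleven_of_isIsogenous_cmCurve_prod_isSimple_threefold_of_isEmpty_ringHom`): Moonen–Zarhin Prop. (3.8) and Thm. 0.1 (4)(a).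
[cite: MoonenZarhin1999LowDim, Thm. 0.1 (4)(a) and Prop. (3.8)] -/
theorem mtRank_hodge_one_eq_ten_of_isIsogenous_cmCurve_prod_isSimple_threefold_of_nonempty_ringHom (hX : IsSmoothProjective n X.X)
    {E T : AbelianVariety ℂ} (hE1 : E.dim = 1) (hEcm : IsOfCMType E) (hTs : T.IsSimple) (hT3 : T.dim = 3)
    (hTE : Module.finrank ℚ T.endAlgebra = 2) (hfor : Nonempty (E.endAlgebra →+* T.endAlgebra)) (hXP : IsIsogenous X (E.prod T)) :
    haveI := BettiUniverse.finite hX 1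
    (BettiUniverse.hodge exists_isReal_hodgeModel_holds hX 1).mtRank = 10 := by
  obtain ⟨f⟩ := hfor
  obtain ⟨χ, φ, D, hD, hχ, hφ, hmult⟩ := exists_matched_cm_data_of_ringHom hE1 hEcm hTs hT3 f
  exact mtRank_hodge_one_eq_ten_of_isIsogenous_cmCurve_prod_isSimple_threefold_sameField hX hE1 hTs hT3 hTE χ φ hD hχ hφ hmult hXP

/-- **THE `E_CM × T_IV(2,1)` COLUMN AS AN IFF: `t(E × T) = 10 ↔ End⁰E ↪ End⁰T`** (and `= 11` otherwise) — Moonen–Zarhin Prop. (3.8) «`Hg(X × E) =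
Hg(X) × Hg(E)` unless `k = End⁰E` embeds into the centre of `End⁰X`» together with Thm. 0.1 (4)(a) «in the same-field case the Weil classes make
`Hg(E × T)` strictly smaller». [cite: MoonenZarhin1999LowDim, Thm. 0.1 (4)(a) and Prop. (3.8)] -/
theorem mtRank_hodge_one_eq_ten_iff_nonempty_ringHom_of_isIsogenous_cmCurve_prod_isSimple_threefold (hX : IsSmoothProjective n X.X)
    {E T : AbelianVariety ℂ} (hE1 : E.dim = 1) (hEcm : IsOfCMType E) (hTs : T.IsSimple) (hT3 : T.dim = 3)
    (hTE : Module.finrank ℚ T.endAlgebra = 2) (hXP : IsIsogenous X (E.prod T)) :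
    haveI := BettiUniverse.finite hX 1
    (BettiUniverse.hodge exists_isReal_hodgeModel_holds hX 1).mtRank = 10 ↔ Nonempty (E.endAlgebra →+* T.endAlgebra) := by
  refine ⟨fun h10 => ?_, fun hfor =>
    mtRank_hodge_one_eq_ten_of_isIsogenous_cmCurve_prod_isSimple_threefold_of_nonempty_ringHom hX hE1 hEcm hTs hT3 hTE hfor hXP⟩
  by_contra hfor
  rw [not_nonempty_iff] at hfor
  have h11 := mtRank_hodge_one_eq_eleven_of_isIsogenous_cmCurve_prod_isSimple_threefold_of_isEmpty_ringHom hX hE1 hEcm hTs hT3 hTE hfor hXP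
  omega

/-- **`t(E × T) = 11 ↔ End⁰E ↛ End⁰T`** for a CM elliptic curve `E` and a simple abelian threefold `T` with `dim_ℚ End⁰T = 2` (the other half of the
column). [cite: MoonenZarhin1999LowDim, Thm. 0.1 (4)(a) and Prop. (3.8)] -/
theorem mtRank_hodge_one_eq_eleven_iff_isEmpty_ringHom_of_isIsogenous_cmCurve_prod_isSimple_threefold (hX : IsSmoothProjective n X.X)
    {E T : AbelianVariety ℂ} (hE1 : E.dim = 1) (hEcm : IsOfCMType E) (hTs : T.IsSimple) (hT3 : T.dim = 3)
    (hTE : Module.finrank ℚ T.endAlgebra = 2) (hXP : IsIsogenous X (E.prod T)) :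
    haveI := BettiUniverse.finite hX 1
    (BettiUniverse.hodge exists_isReal_hodgeModel_holds hX 1).mtRank = 11 ↔ IsEmpty (E.endAlgebra →+* T.endAlgebra) := by
  refine ⟨fun h11 => ?_, fun hfor =>
    mtRank_hodge_one_eq_eleven_of_isIsogenous_cmCurve_prod_isSimple_threefold_of_isEmpty_ringHom hX hE1 hEcm hTs hT3 hTE hfor hXP⟩
  by_contra hfor
  rw [not_isEmpty_iff] at hfor
  have h10 := mtRank_hodge_one_eq_ten_of_isIsogenous_cmCurve_prod_isSimple_threefold_of_nonempty_ringHom hX hE1 hEcm hTs hT3 hTE hfor hXP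
  omega

end FieldForm

end Summit.HodgeConjecture.CorCM

end
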